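import Literature.NumberTheory.EllipticCurves.ModularCurveManinSemistableBridgeProofs
import Literature.NumberTheory.EllipticCurves.CuspFormLFunctionLevelConductorProofs
import Literature.NumberTheory.DiophantineGeometry.PastenValuationProductsProofs
import HarnessLib

/-!
# `abs_maninConstant_eq_one_of_isSemistable` from the printed, prime-by-prime form of
# Česnavičius's theorem

Topic `NumberTheory/EllipticCurves`; a proofs-only companion (theorems only: no definitions, no
named facts) of `ModularCurve.lean`, closing the series
`ModularCurveManinSemistableProofs` / `…KernelProofs` / `…BridgeProofs`.

The source. K. Česnavičius, *The Manin constant in the semistable case*, Compositio Math. 154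
(2018), Thm. 1.2, in the case `H = Γ₀(n)` (the theorem labelled `Manin-sst` in §2 of the paper):
*"For a new elliptic optimal quotient `π : J₀(n) ↠ E`, the Manin constant `c_π` satisfies
`v_p(c_π) = 0` for every prime `p` such that `p² ∤ n`."* — followed, in the statement of Thm. 1.2,
by *"In particular, [the Manin conjecture `c_π = ±1`] holds when `E` is semistable."* The printed
theorem is thus **prime-by-prime**; the vendored named fact
`ModularParametrizationData.abs_maninConstant_eq_one_of_isSemistable` is its "in particular".

What the earlier files established (all theorems of the tree). `…BridgeProofs` proved
`abs_maninConstant_eq_one_of_isSemistable_of_cesnavicius`: the fact follows from `hCes`,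
Česnavičius's theorem **in lattice form for semistable curves** (`|c| = 1` for every datum `D'`
on a globally minimal model `W'` of a semistable elliptic curve with `c Λ_f = Λ_{E'}`, i.e. for
the optimal parametrisation read against the Néron differential), and
`forall_abs_maninConstant_eq_one_of_isSemistable_iff_cesnavicius`: the universal closure of the
fact is *equivalent* to `hCes`, with no hypothesis.

This file performs the paper's own last step, the passage from the prime-by-prime theorem to
its semistable corollary, inside the tree:

* `ModularParametrizationData.squarefree_level_of_isSemistable`,
  `ModularParametrizationData.not_sq_dvd_level_of_isSemistable` — for a datum `D` at level `N`
  of a *semistable* elliptic `W/ℚ`, the level `N` is squarefree, so `p² ∤ N` for every prime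
  `p`: `W` semistable iff `N_W` squarefree
  (`WeierstrassCurve.isSemistable_iff_squarefree_conductorNorm`, Silverman ATAEC IV.10.2), and
  `N = N_W` for squarefree `N_W` (`IsNewformOf.level_eq_conductorNorm_of_squarefree`, the
  squarefree case of Carayol's theorem, proved in the tree from Atkin–Lehner 1970, Thm. 3);
* `ModularParametrizationData.abs_maninConstant_eq_one_of_forall_prime_not_dvd` — an integer
  Manin constant with no prime divisor is `±1`;
* `ModularParametrizationData.cesnavicius_latticeForm_of_primewise` — **the "in particular" of
  Thm. 1.2**: the prime-by-prime theorem in lattice form (`h12`: for every datum `D'` on a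
  globally minimal `W'` with `c Λ_f = Λ_{E'}` and every prime `p` with `p² ∤ N'`, `p ∤ c`)
  implies `hCes`;
* `ModularParametrizationData.abs_maninConstant_eq_one_of_isSemistable_of_primewise` — **the
  fact from the printed prime-by-prime theorem alone**;
* `ModularParametrizationData.forall_abs_maninConstant_eq_one_of_isSemistable_iff_primewise` —
  the universal closure of the fact is **equivalent** to the prime-by-prime statement
  *restricted to semistable curves* (`p ∤ c` for every prime `p`, every optimal datum on a
  globally minimal model of a semistable curve), again with no hypothesis.

So the open content of the fact is exactly Thm. 1.2 for semistable curves; the full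
prime-by-prime theorem (which also constrains non-semistable optimal curves at the primes
`p` with `p² ∤ n`) is stronger and implies it. Its proof (Néron models of `J₀(n)` and `E` over
`ℤ_(p)`, the Deligne–Rapoport model of `X₀(n)`, Grothendieck duality, multiplicity one at `p`
and the congruence-number identity `v_p(#cong) = v_p(deg)`, Česnavičius 2018, §2) is not
attempted: none of that vocabulary exists in Mathlib or `Literature/` yet.

Nothing is discharged and no statement of the tree is changed.

## References

* K. Česnavičius, *The Manin constant in the semistable case*, Compositio Math. 154 (2018),
  1889–1920, doi:10.1112/s0010437x18007273: Thm. 1.2 and §2 (Thm. `Manin-sst`).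
  [Cesnavicius2018]
* B. Edixhoven, *On the Manin constants of modular elliptic curves*, in: Arithmetic Algebraic
  Geometry (Texel 1989), Progr. Math. 89 (1991), Prop. 2 (`c_π ∈ ℤ`). [EdixhovenManin1991]
* J. H. Silverman, *Advanced Topics in the Arithmetic of Elliptic Curves*, GTM 151 (1994),
  Thm. IV.10.2 (semistable iff squarefree conductor). [Silverman1994]
* A. O. L. Atkin, J. Lehner, *Hecke operators on `Γ₀(m)`*, Math. Ann. 185 (1970), Thm. 3;
  F. Diamond, J. Shurman, *A First Course in Modular Forms*, GTM 228 (2005), Thm. 8.8.1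
  (level `=` conductor). [AtkinLehner1970] [DiamondShurman2005]
-/

noncomputable section

open scoped MatrixGroups ModularForm

open CongruenceSubgroup UpperHalfPlane

namespace Literature.NumberTheory.EllipticCurves.ModularForms

namespace ModularParametrizationData

variable {W : WeierstrassCurve ℚ} {N : ℕ} [NeZero N]

/-! ### The level of a datum of a semistable curve is squarefree -/

/-- **The level of a parametrisation datum of a semistable curve is squarefree.** If `W/ℚ` is
elliptic and semistable and `D` is a modular parametrisation datum of `W` at level `N`, then `N`
is squarefree: the conductor `N_W` is squarefree
(`WeierstrassCurve.isSemistable_iff_squarefree_conductorNorm`, Silverman ATAEC IV.10.2), and the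
level of the newform `D.f` of `W` equals `N_W` when `N_W` is squarefree
(`IsNewformOf.level_eq_conductorNorm_of_squarefree`, Atkin–Lehner 1970, Thm. 3 with
Diamond–Shurman Thm. 8.8.1). [cite: Silverman1994, Thm. IV.10.2] [cite: AtkinLehner1970, Thm. 3] -/
theorem squarefree_level_of_isSemistable [W.IsElliptic] (D : ModularParametrizationData W N)
    (hss : W.IsSemistable ℤ) : Squarefree N := by
  have hsq : Squarefree (W.conductorNorm ℤ) := (W.isSemistable_iff_squarefree_conductorNorm).mp hss
  rwa [IsNewformOf.level_eq_conductorNorm_of_squarefree D.isNewformOf hsq]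

/-- **`p² ∤ N` at every prime for a datum of a semistable curve** — the hypothesis of
Česnavičius's prime-by-prime theorem holds at *every* prime when `E` is semistable (this is the
"in particular" in the statement of Thm. 1.2). [cite: Cesnavicius2018, Thm. 1.2] -/
theorem not_sq_dvd_level_of_isSemistable [W.IsElliptic] (D : ModularParametrizationData W N)
    (hss : W.IsSemistable ℤ) {p : ℕ} (hp : p.Prime) : ¬ p ^ 2 ∣ N := by
  rw [sq]
  exact Nat.squarefree_iff_prime_squarefree.mp (D.squarefree_level_of_isSemistable hss) p hp

variable (D : ModularParametrizationData W N)

/-! ### An integer with no prime divisor is `±1` -/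

/-- If no prime divides the (integer) Manin constant `c`, then `|c| = 1`. [folklore] -/
theorem abs_maninConstant_eq_one_of_forall_prime_not_dvd
    (h : ∀ p : ℕ, p.Prime → ¬ (p : ℤ) ∣ D.maninConstant) : |D.maninConstant| = 1 := by
  by_contra hne
  have h1 : D.maninConstant.natAbs ≠ 1 := fun h1 ↦ hne (by rw [Int.abs_eq_natAbs, h1, Nat.cast_one])
  obtain ⟨p, hp, hpd⟩ := Nat.exists_prime_and_dvd h1
  exact h p hp (Int.natCast_dvd.mpr hpd)

/-- Conversely, if `|c| = 1` then no prime divides `c`. [folklore] -/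
theorem forall_prime_not_dvd_of_abs_maninConstant_eq_one (h : |D.maninConstant| = 1) (p : ℕ)
    (hp : p.Prime) : ¬ (p : ℤ) ∣ D.maninConstant := by
  intro hpd
  have h1 : p ∣ 1 := by
    have := Int.natCast_dvd.mp hpd
    rwa [← Int.natAbs_abs, h] at this
  exact hp.one_lt.ne' (Nat.dvd_one.mp h1)

/-! ### The "in particular" of Thm. 1.2: from the prime-by-prime theorem to the lattice form -/

/-- **Česnavičius's Thm. 1.2, prime-by-prime, implies its semistable case in lattice form.**
Assume (`h12`) the printed theorem for `Γ₀`-optimal parametrisations, in lattice language: for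
every globally minimal model `W'/ℚ` of an elliptic curve (so that `Λ_{E'}` is the Néron lattice
and `ω_{W'}` a Néron differential), every datum `D'` at level `N'` with `c Λ_f = Λ_{E'}` (i.e.
`φ_{D'}` is the optimal parametrisation, `π : J₀(N') ↠ E'` has connected kernel) and every prime
`p` with `p² ∤ N'`, `p ∤ c` (`v_p(c_π) = 0`; `c_π ∈ ℤ` is built into the datum, Edixhoven 1991,
Prop. 2). Then `hCes` holds: `|c| = 1` for every such datum on a *semistable* curve — because
then `p² ∤ N'` for every prime `p` (`not_sq_dvd_level_of_isSemistable`), so no prime divides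
`c`. This is the sentence "In particular, (the Manin conjecture) holds when `E` is semistable" of
the statement of Thm. 1.2, performed in the tree. [cite: Cesnavicius2018, Thm. 1.2] -/
theorem cesnavicius_latticeForm_of_primewise
    (h12 : ∀ (W' : WeierstrassCurve ℚ) [W'.IsElliptic] [W'.IsGloballyMinimal] {N' : ℕ} [NeZero N']
      (D' : ModularParametrizationData W' N'),
      (∀ z ∈ D'.L.lattice, ∃ w ∈ periodLattice D'.f, z = D'.c * w) →
      ∀ p : ℕ, p.Prime → ¬ p ^ 2 ∣ N' → ¬ (p : ℤ) ∣ D'.maninConstant)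
    (W' : WeierstrassCurve ℚ) [W'.IsElliptic] [W'.IsGloballyMinimal] {N' : ℕ} [NeZero N']
    (D' : ModularParametrizationData W' N') (hss : W'.IsSemistable ℤ)
    (hlat : ∀ z ∈ D'.L.lattice, ∃ w ∈ periodLattice D'.f, z = D'.c * w) :
    |D'.maninConstant| = 1 :=
  D'.abs_maninConstant_eq_one_of_forall_prime_not_dvd fun _ hp ↦
    h12 W' D' hlat _ hp (D'.not_sq_dvd_level_of_isSemistable hss hp)

/-! ### The fact from the printed prime-by-prime theorem alone -/

/-- **`abs_maninConstant_eq_one_of_isSemistable` from Česnavičius's Thm. 1.2 as printed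
(prime-by-prime), with no other input.** Assume (`h12`) the theorem for `Γ₀`-optimal
parametrisations in lattice language (see `cesnavicius_latticeForm_of_primewise`): for every
datum `D'` on a globally minimal `W'` with `c Λ_f = Λ_{E'}` and every prime `p` with `p² ∤ N'`,
`p ∤ c`. Then the vendored fact holds for `D`: combine the paper's "in particular"
(`cesnavicius_latticeForm_of_primewise`: semistable `⇒` level squarefree `⇒` `p² ∤ N'` for all
`p` `⇒` `|c| = 1`) with `abs_maninConstant_eq_one_of_isSemistable_of_cesnavicius` (a datum of
minimal degree is optimal, `c Λ_f = Λ_E`, by comparison with the unconditional optimal datum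
`exists_optimalDatum'`). The hypothesis `h12` is a transcription of the printed theorem for
`H = Γ₀(n)` and nothing more; it is the only input. [cite: Cesnavicius2018, Thm. 1.2] -/
theorem abs_maninConstant_eq_one_of_isSemistable_of_primewise
    (h12 : ∀ (W' : WeierstrassCurve ℚ) [W'.IsElliptic] [W'.IsGloballyMinimal] {N' : ℕ} [NeZero N']
      (D' : ModularParametrizationData W' N'),
      (∀ z ∈ D'.L.lattice, ∃ w ∈ periodLattice D'.f, z = D'.c * w) →
      ∀ p : ℕ, p.Prime → ¬ p ^ 2 ∣ N' → ¬ (p : ℤ) ∣ D'.maninConstant) :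
    D.abs_maninConstant_eq_one_of_isSemistable :=
  D.abs_maninConstant_eq_one_of_isSemistable_of_cesnavicius fun W' _ _ _ _ D' hss hlat ↦
    cesnavicius_latticeForm_of_primewise h12 W' D' hss hlat

/-- **The exact open content, prime-by-prime form.** The universal closure of the vendored fact
`abs_maninConstant_eq_one_of_isSemistable` (what a discharge `_holds` proves) is **equivalent**
to Česnavičius's Thm. 1.2 *for semistable curves*, stated prime-by-prime in lattice language:
for every globally minimal model `W'/ℚ` of a semistable elliptic curve, every datum `D'` with
`c Λ_f = Λ_{E'}` and every prime `p`, `p ∤ c` (`v_p(c_π) = 0`; for semistable `E'` the printed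
proviso `p² ∤ n` holds at every `p`, `not_sq_dvd_level_of_isSemistable`). `⇒`: the fact for all
data gives `|c| = 1` for such `D'`
(`cesnavicius_latticeForm_of_forall_abs_maninConstant_eq_one`: an optimal datum has minimal
degree), hence no prime divisor; `⇐`: no prime divisor gives `|c| = 1`, i.e. `hCes`, and
`abs_maninConstant_eq_one_of_isSemistable_of_cesnavicius` applies. No hypothesis.
[cite: Cesnavicius2018, Thm. 1.2] -/
theorem forall_abs_maninConstant_eq_one_of_isSemistable_iff_primewise :
    (∀ {W' : WeierstrassCurve ℚ} {N' : ℕ} [NeZero N'] (D' : ModularParametrizationData W' N'),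
      D'.abs_maninConstant_eq_one_of_isSemistable) ↔
    ∀ (W' : WeierstrassCurve ℚ) [W'.IsElliptic] [W'.IsGloballyMinimal] {N' : ℕ} [NeZero N']
      (D' : ModularParametrizationData W' N'), W'.IsSemistable ℤ →
      (∀ z ∈ D'.L.lattice, ∃ w ∈ periodLattice D'.f, z = D'.c * w) →
      ∀ p : ℕ, p.Prime → ¬ (p : ℤ) ∣ D'.maninConstant :=
  ⟨fun h W' _ _ _ _ D' hss hlat ↦ D'.forall_prime_not_dvd_of_abs_maninConstant_eq_one
      (cesnavicius_latticeForm_of_forall_abs_maninConstant_eq_one h W' D' hss hlat),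
    fun h _ _ _ D' ↦ D'.abs_maninConstant_eq_one_of_isSemistable_of_cesnavicius
      fun W'' _ _ _ _ D'' hss hlat ↦ D''.abs_maninConstant_eq_one_of_forall_prime_not_dvd
        (h W'' D'' hss hlat)⟩

/-- **The prime-by-prime theorem implies the prime-by-prime statement for semistable curves**
(the right-hand side of `forall_abs_maninConstant_eq_one_of_isSemistable_iff_primewise`): for
semistable `E'` the proviso `p² ∤ N'` of Thm. 1.2 is automatic. Together with that equivalence
this exhibits the vendored fact as a consequence of the printed theorem, the converse failing
only in that Thm. 1.2 also constrains non-semistable optimal curves at the primes `p ∤ n` and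
`p ∥ n`. [cite: Cesnavicius2018, Thm. 1.2] -/
theorem primewise_semistable_of_primewise
    (h12 : ∀ (W' : WeierstrassCurve ℚ) [W'.IsElliptic] [W'.IsGloballyMinimal] {N' : ℕ} [NeZero N']
      (D' : ModularParametrizationData W' N'),
      (∀ z ∈ D'.L.lattice, ∃ w ∈ periodLattice D'.f, z = D'.c * w) →
      ∀ p : ℕ, p.Prime → ¬ p ^ 2 ∣ N' → ¬ (p : ℤ) ∣ D'.maninConstant)
    (W' : WeierstrassCurve ℚ) [W'.IsElliptic] [W'.IsGloballyMinimal] {N' : ℕ} [NeZero N']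
    (D' : ModularParametrizationData W' N') (hss : W'.IsSemistable ℤ)
    (hlat : ∀ z ∈ D'.L.lattice, ∃ w ∈ periodLattice D'.f, z = D'.c * w) (p : ℕ) (hp : p.Prime) :
    ¬ (p : ℤ) ∣ D'.maninConstant :=
  h12 W' D' hlat p hp (D'.not_sq_dvd_level_of_isSemistable hss hp)

end ModularParametrizationData

end Literature.NumberTheory.EllipticCurves.ModularForms

end
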